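import Summits.ValiantsHypothesis.ValiantsHypothesis.Theorems.LacunarySymmetroidMatrixDescartesCensusV19SSoundTerms
import Summits.ValiantsHypothesis.ValiantsHypothesis.Theorems.LacunarySymmetroidMatrixDescartesCensusNineteenFlank
import Summits.ValiantsHypothesis.ValiantsHypothesis.Theorems.LacunarySymmetroidMatrixDescartesCensusNineteenKit

/-!
# `MatrixDescartes` census — soundness of the 2-SIDON `V = 19` checker: every accepted row holds in the model

HONEST FRAMING.  Object-search cell `pub-symmetroid`; door-A item `DoorA26 = PosRootLawAt 2 6 19`
(stmt-ValiantsHypothesis-19979; OPEN, typed, never asserted).  Part of the proof that certificates accepted by `V19S.certOK` (`…CensusV19SCheck`)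
exclude a nineteen on a 2-Sidon support (semantics `…CensusV19SModel`): `V19S.buildRow_sound` — the Newton-cone rows of both modes (model fields),
the WINDOW rows of mode `A` (from the model's window balances: drop a non-negative term, or use the branch inequality of the middle window, then
`Census.flank_amgm_row` turns the two-term bound at one point into the log-linear row with the checker's factored constants), and the
single-positive-term / AM–GM rows of `G3, RCS, W ≥ 0` after deleting the terms through the zero atom (twin of `…CensusV19CSoundRows`).  Nothing here
bears on the one-collision supports, on `ζ_sym(2,6)` over all supports, on `DoorA26` itself, on `MatrixDescartes` (stmt-ValiantsHypothesis-18050)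
or on `VP ≠ VNP`.

[folklore] Certificate-checker soundness; elementary.
-/

-- the D-0017 layout repeats a namespace component (single-conjunct summit); the `dupNamespace` linter flags it; name mandated.
set_option linter.dupNamespace false

namespace Summit.ValiantsHypothesis.ValiantsHypothesis.Theorems.LacunarySymmetroidMatrixDescartes.Census.V19S

open V20 (Atom allAtoms psum posOf qA cA Term PolySpec posl oddTrues FNat fval Row rowC25 rowOne rowAmgm FRat negAt sums Epos
  G3poly RCSpoly Wpoly tval pval lprod xpow frval BPos lprod_pos lprod_cons lprod_append lprod_replicate lprod_flatten atoms_valid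
  coeff_ne_zero qA_mem cA_mem term_getD_mem pval_eq_sum_range fval_nil fval_cons fval_singleton fval_append fval_map_one fval_pos
  dist1_pos fval_map_const sums_getD Epos_lt)
open V19C (amgm_list)

section Rows

open Finset

variable {c : Ctx} {x : ℕ → ℝ} {v : Atom → ℝ}

/-- `posIndex` returns the unique non-zero positive term of a valid inequality (and, for `RCS`, a definite first letter). [folklore] -/
theorem posIndex_spec {P : PolySpec} {p : ℕ} (h : V19S.posIndex c P = some p) :
    P.valid = true ∧ posTerms c P.poly = [p] ∧ (∀ i j, P = .rcs i j → atomPos c (qA i) = true) := by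
  unfold posIndex at h
  split_ifs at h with hc
  rw [Bool.and_eq_true] at hc
  refine ⟨hc.1, ?_, ?_⟩
  · split at h
    · next q heq => cases h; exact heq
    · cases h
  · intro i j hP
    subst hP
    simpa [defOK] using hc.2

/-- The named inequality holds in the model (for `RCS` given a definite first letter). [folklore] -/
theorem pval_nonneg (M : V19S.Model c x v) (P : PolySpec) (hP : P.valid = true)
    (hdef : ∀ i j, P = .rcs i j → atomPos c (qA i) = true) : 0 ≤ pval v P.poly := by
  cases P with
  | g3 i j k =>
    simp only [PolySpec.valid, decide_eq_true_eq] at hP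
    exact M.g3 i j k hP.1 hP.2.1 hP.2.2
  | rcs i j =>
    simp only [PolySpec.valid, decide_eq_true_eq] at hP
    have hq : 0 < v (qA i) := M.v_pos (qA_mem hP.1) (hdef i j rfl)
    exact M.rcs i j hP.1 hP.2.1 hP.2.2 hq
  | w i j k l =>
    simp only [PolySpec.valid, decide_eq_true_eq] at hP
    obtain ⟨hi, hj, hk, hl, h1, h2, h3, h4, h5, h6⟩ := hP
    exact M.w i j k l hi hj hk hl h1 h2 h3 h4 h5 h6

/-- The positive index is an index. [folklore] -/
theorem lt_length_of_posTerms_eq {P : List Term} {p : ℕ} (hpos : V19S.posTerms c P = [p]) : p < P.length :=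
  lt_length_of_mem_posTerms (c := c) (by rw [hpos]; simp)

/-- The single-positive row `|tₙ| ≤ t_p` holds (term `n` without the zero atom). [folklore] -/
theorem rowOne_holds (M : V19S.Model c x v) {P : PolySpec} {p n : ℕ} (hp : posIndex c P = some p)
    (hn : n < P.poly.length) (hnp : n ≠ p) (hz : termZero c (P.poly.getD n (0, [])) = false) :
    (rowOne c.ord P.poly p n).Holds x := by
  obtain ⟨hval, hpos, hdef⟩ := posIndex_spec hp
  have hP := pval_nonneg M P hval hdef
  obtain ⟨hsum, -⟩ := sum_abs_le_pos M P hval hpos hP [n] (by simpa using ⟨hn, hnp⟩) (List.nodup_singleton n)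
  simp only [List.map_cons, List.map_nil, List.sum_cons, List.sum_nil, add_zero] at hsum
  have hpl := lt_length_of_posTerms_eq hpos
  have hTn := atoms_valid P hval _ (term_getD_mem P.poly hn)
  have hTp := atoms_valid P hval _ (term_getD_mem P.poly hpl)
  rw [abs_tval_eq M _ hTn hz] at hsum
  have hpm := (mem_posTerms_iff (c := c) hpl).1 (by rw [hpos]; simp)
  rw [tval_eq_of_not_termNeg M _ hTp hpm.1 hpm.2] at hsum
  unfold Row.Holds rowOne
  simp only [fval_singleton, pow_one, Nat.cast_natAbs, Int.cast_abs]
  linarith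

/-- The AM–GM row holds (terms of `S` without the zero atom). [folklore] -/
theorem rowAmgm_holds (M : V19S.Model c x v) {P : PolySpec} {p : ℕ} (hp : posIndex c P = some p)
    (S : List ℕ) (hS : ∀ j ∈ S, j < P.poly.length ∧ j ≠ p) (hSz : ∀ j ∈ S, termZero c (P.poly.getD j (0, [])) = false)
    (hSnd : S.Nodup) : (rowAmgm c.ord P.poly p S).Holds x := by
  obtain ⟨hval, hpos, hdef⟩ := posIndex_spec hp
  have hP := pval_nonneg M P hval hdef
  obtain ⟨hsum, hp0⟩ := sum_abs_le_pos M P hval hpos hP S hS hSnd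
  have hpl := lt_length_of_posTerms_eq hpos
  have hTp := atoms_valid P hval _ (term_getD_mem P.poly hpl)
  have hpm := (mem_posTerms_iff (c := c) hpl).1 (by rw [hpos]; simp)
  -- abbreviations: `g j` = |coefficient|, `m j` = monomial of position magnitudes
  set g : ℕ → ℝ := fun j => |((P.poly.getD j (0, [])).1 : ℝ)| with hg
  set m : ℕ → ℝ := fun j => lprod x (posl c.ord (P.poly.getD j (0, [])).2) with hm
  have habs : (S.map fun j => |tval v (P.poly.getD j (0, []))|) = S.map fun j => g j * m j := by
    refine List.map_congr_left fun j hj => ?_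
    exact abs_tval_eq M _ (atoms_valid P hval _ (term_getD_mem P.poly (hS j hj).1)) (hSz j hj)
  rw [habs] at hsum
  have htp : tval v (P.poly.getD p (0, [])) = g p * m p := tval_eq_of_not_termNeg M _ hTp hpm.1 hpm.2
  rw [htp] at hsum hp0
  -- AM–GM on the list `a_j = g j * m j`
  set A : List ℝ := S.map fun j => g j * m j with hA
  have hAnn : ∀ a ∈ A, 0 ≤ a := by
    intro a ha; rw [hA, List.mem_map] at ha; obtain ⟨j, -, rfl⟩ := ha
    exact mul_nonneg (abs_nonneg _) (lprod_pos M.xpos _).le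
  have hAlen : A.length = S.length := by simp [hA]
  have hmain := amgm_list A hAnn
  rw [hAlen] at hmain
  have hstep : (S.length : ℝ) ^ S.length * A.prod ≤ (g p * m p) ^ S.length :=
    hmain.trans (pow_le_pow_left₀ (List.sum_nonneg hAnn) hsum _)
  have hAprod : A.prod = (S.map g).prod * (S.map m).prod := by rw [hA, List.prod_map_mul]
  have hL : lprod x (rowAmgm c.ord P.poly p S).L = (S.map m).prod := by
    show lprod x (S.map fun j => posl c.ord (P.poly.getD j (0, [])).2).flatten = (S.map m).prod
    rw [lprod_flatten, List.map_map]; rfl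
  have hR : lprod x (rowAmgm c.ord P.poly p S).R = m p ^ S.length := by
    show lprod x (List.replicate S.length (posl c.ord (P.poly.getD p (0, [])).2)).flatten = m p ^ S.length
    rw [lprod_flatten, List.map_replicate, List.prod_replicate]
  have hBden : (fval (rowAmgm c.ord P.poly p S).Bden : ℝ) = (S.length : ℝ) ^ S.length * (S.map g).prod := by
    show (fval ((S.length, S.length) :: S.map fun j => ((fun i => (P.poly.getD i (0, [])).1.natAbs) j, 1)) : ℝ)
      = (S.length : ℝ) ^ S.length * (S.map g).prod
    rw [fval_cons, Nat.cast_mul, Nat.cast_pow, fval_map_one]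
    congr 1
    exact congrArg List.prod (List.map_congr_left fun j _ => by rw [Nat.cast_natAbs, Int.cast_abs])
  have hBnum : (fval (rowAmgm c.ord P.poly p S).Bnum : ℝ) = g p ^ S.length := by
    show (fval [((P.poly.getD p (0, [])).1.natAbs, S.length)] : ℝ) = g p ^ S.length
    rw [fval_singleton]; push_cast; rw [Nat.cast_natAbs, Int.cast_abs]
  unfold Row.Holds
  rw [hL, hR, hBden, hBnum]
  calc (S.map m).prod * ((S.length : ℝ) ^ S.length * (S.map g).prod)
      = (S.length : ℝ) ^ S.length * A.prod := by rw [hAprod]; ring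
    _ ≤ (g p * m p) ^ S.length := hstep
    _ = m p ^ S.length * g p ^ S.length := by ring

/-! ### Window rows -/

/-- The reduced weight to the power `n` is the `n`-th power of the reduced weight. [folklore] -/
theorem fval_redW (E W : List ℕ) (e n : ℕ) : (fval (redW E W e n) : ℝ) = (fval (redW E W e 1) : ℝ) ^ n := by
  unfold redW
  rw [fval_map_const, fval_map_const, pow_one]
  push_cast; rfl

/-- Every base of a reduced weight is positive. [folklore] -/
theorem redW_pos (E W : List ℕ) (e n : ℕ) : ∀ be ∈ redW E W e n, 0 < be.1 := by
  intro be hbe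
  unfold redW at hbe
  rw [List.mem_map] at hbe
  obtain ⟨u, -, rfl⟩ := hbe
  dsimp only
  split_ifs
  · exact one_pos
  · exact dist1_pos _ _

/-- A window term is non-negative. [folklore] -/
theorem wterm_nonneg (M : V19S.Model c x v) (w0 t : ℕ) {y : ℝ} (hy : 0 < y) : 0 ≤ wterm c x w0 t y := by
  unfold wterm redWR
  exact mul_nonneg (mul_nonneg (M.xpos t).le (Nat.cast_nonneg _)) (pow_nonneg hy.le _)

/-- Sums at positions: `c.E.getD t 0 = Epos c.d c.ord t` for `t < 21`. [folklore] -/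
theorem E_getD (M : V19S.Model c x v) {t : ℕ} (ht : t < 21) : c.E.getD t 0 = Epos c.d c.ord t := by
  rw [M.wf.hE]; exact sums_getD M.wf.hord ht

/-- Sums at positions increase strictly. [folklore] -/
theorem E_getD_lt (M : V19S.Model c x v) {t u : ℕ} (htu : t < u) (hu : u < 21) : c.E.getD t 0 < c.E.getD u 0 := by
  rw [E_getD M (htu.trans hu), E_getD M hu]; exact Epos_lt M.wf.hord htu hu

/-- What `winSpec` licenses: the three windows with their admissible trinomials, factors and (for the middle window) the branch. [folklore] -/
theorem winSpec_cases {k : ℕ} {mid : Option ℕ} {p q r w0 φ : ℕ} (h : winSpec k mid p q r = some (w0, φ)) :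
    (2 ≤ k ∧ p + 2 = k ∧ q + 1 = k ∧ (r = k ∨ r = k + 1) ∧ w0 = k - 2 ∧ φ = 1) ∨
    (k + 3 ≤ 20 ∧ q = k + 2 ∧ r = k + 3 ∧ (p = k ∨ p = k + 1) ∧ w0 = k ∧ φ = 1) ∨
    (1 ≤ k ∧ k + 2 ≤ 20 ∧ p + 1 = k ∧ r = k + 2 ∧ (q = k ∨ q = k + 1) ∧ mid = some q ∧ w0 = k - 1 ∧ φ = 2) := by
  unfold winSpec at h
  split_ifs at h with h1 h2 h3
  · left; simp only [Option.some.injEq, Prod.mk.injEq] at h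
    exact ⟨h1.1, h1.2.1, h1.2.2.1, h1.2.2.2, h.1.symm, h.2.symm⟩
  · right; left; simp only [Option.some.injEq, Prod.mk.injEq] at h
    exact ⟨h2.1, h2.2.1, h2.2.2.1, h2.2.2.2, h.1.symm, h.2.symm⟩
  · right; right; simp only [Option.some.injEq, Prod.mk.injEq] at h
    exact ⟨h3.1, h3.2.1, h3.2.2.1, h3.2.2.2.1, h3.2.2.2.2.1, h3.2.2.2.2.2, h.1.symm, h.2.symm⟩

/-- In mode `A k`, a licensed window row admits a two-term bound `T_p(y) + T_r(y) ≤ φ·T_q(y)` at some `y > 0` (window terms of the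
licensed window). [folklore] -/
theorem two_term_of_winSpec (M : V19S.Model c x v) {k : ℕ} (hk : c.mode = .A k) {p q r w0 φ : ℕ}
    (h : winSpec k c.mid p q r = some (w0, φ)) :
    ∃ y : ℝ, 0 < y ∧ wterm c x w0 p y + wterm c x w0 r y ≤ (φ : ℝ) * wterm c x w0 q y := by
  rcases winSpec_cases h with ⟨h2, hp, hq, hr, hw, hφ⟩ | ⟨h3, hq, hr, hp, hw, hφ⟩ | ⟨h1, h2, hp, hr, hq, hmid, hw, hφ⟩
  · -- left window
    obtain ⟨y, hy, hbal⟩ := M.winLow k hk h2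
    refine ⟨y, hy, ?_⟩
    have h0 := wterm_nonneg M (k - 2) k hy
    have h0' := wterm_nonneg M (k - 2) (k + 1) hy
    have ep : p = k - 2 := by omega
    have eq : q = k - 1 := by omega
    rw [hw, hφ, ep, eq]
    rcases hr with hr | hr <;> · rw [hr]; push_cast; linarith
  · -- right window
    obtain ⟨y, hy, hbal⟩ := M.winHigh k hk h3
    refine ⟨y, hy, ?_⟩
    have h0 := wterm_nonneg M k k hy
    have h0' := wterm_nonneg M k (k + 1) hy
    rw [hw, hφ, hq, hr]
    rcases hp with hp | hp <;> · rw [hp]; push_cast; linarith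
  · -- middle window, inside a branch
    obtain ⟨y, hy, hbal, hbk, hbk1⟩ := M.winMid k hk h1 h2
    refine ⟨y, hy, ?_⟩
    have ep : p = k - 1 := by omega
    rw [hw, hφ, ep, hr]
    rcases hq with hq | hq
    · rw [hq] at hmid ⊢; have := hbk hmid; push_cast; linarith
    · rw [hq] at hmid ⊢; have := hbk1 hmid; push_cast; linarith

/-- The window row built for a licensed `(p, q, r)` holds in the model. [folklore] -/
theorem rowWin_holds (M : V19S.Model c x v) {k : ℕ} (hk : c.mode = .A k) {p q r w0 φ : ℕ}
    (h : winSpec k c.mid p q r = some (w0, φ)) : (rowWin c.E w0 φ p q r).Holds x := by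
  have hk20 : k < 20 := by have := M.wf.hmode; rw [hk] at this; simpa [Mode.ok] using this
  have hlt : p < q ∧ q < r ∧ r < 21 := by
    rcases winSpec_cases h with ⟨-, hp, hq, hr, -⟩ | ⟨h3, hq, hr, hp, -⟩ | ⟨-, h2, hp, hr, hq, -⟩ <;> omega
  obtain ⟨hpq, hqr, hr21⟩ := hlt
  obtain ⟨y, hy, hle⟩ := two_term_of_winSpec M hk h
  have epq := E_getD_lt M hpq (hqr.trans hr21)
  have eqr := E_getD_lt M hqr hr21
  unfold wterm redWR at hle
  unfold Row.Holds rowWin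
  dsimp only
  generalize hep : c.E.getD p 0 = ep at epq hle ⊢
  generalize heq : c.E.getD q 0 = eq at epq eqr hle ⊢
  generalize her : c.E.getD r 0 = er at eqr hle ⊢
  have hPp0 : (0 : ℝ) ≤ (fval (redW c.E (winSums c.E w0) ep 1) : ℝ) := Nat.cast_nonneg _
  have hPr0 : (0 : ℝ) ≤ (fval (redW c.E (winSums c.E w0) er 1) : ℝ) := Nat.cast_nonneg _
  have hle' : x p * (fval (redW c.E (winSums c.E w0) ep 1) : ℝ) * y ^ ep
      + x r * (fval (redW c.E (winSums c.E w0) er 1) : ℝ) * y ^ er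
      ≤ (φ : ℝ) * x q * (fval (redW c.E (winSums c.E w0) eq 1) : ℝ) * y ^ eq := by
    have e : (φ : ℝ) * (x q * (fval (redW c.E (winSums c.E w0) eq 1) : ℝ) * y ^ eq)
        = (φ : ℝ) * x q * (fval (redW c.E (winSums c.E w0) eq 1) : ℝ) * y ^ eq := by ring
    rw [← e]; exact hle
  have key := flank_amgm_row (p := ep) (q := eq) (r := er) (α := eq - ep) (β := er - eq) (n := eq - ep + (er - eq))
    (by omega) (by omega) rfl (by omega) (by omega) rfl rfl (mul_nonneg (M.xpos p).le hPp0) (mul_nonneg (M.xpos r).le hPr0) hy hle'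
  rw [lprod_append, lprod_replicate, lprod_replicate, lprod_replicate]
  simp only [fval_append, fval_cons, fval_nil]
  push_cast
  rw [fval_redW c.E _ ep (er - eq), fval_redW c.E _ er (eq - ep), fval_redW c.E _ eq (eq - ep + (er - eq))]
  calc _ = (((eq - ep : ℕ) : ℝ) + ((er - eq : ℕ) : ℝ)) ^ (eq - ep + (er - eq))
        * (x p * (fval (redW c.E (winSums c.E w0) ep 1) : ℝ)) ^ (er - eq)
        * (x r * (fval (redW c.E (winSums c.E w0) er 1) : ℝ)) ^ (eq - ep) := by ring
    _ ≤ ((eq - ep : ℕ) : ℝ) ^ (eq - ep) * ((er - eq : ℕ) : ℝ) ^ (er - eq)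
        * ((φ : ℝ) * x q * (fval (redW c.E (winSums c.E w0) eq 1) : ℝ)) ^ (eq - ep + (er - eq)) := key
    _ = _ := by ring

/-! ### All rows -/

/-- Every row the checker builds holds in the model and is well formed. [folklore] -/
theorem buildRow_sound (M : V19S.Model c x v) {rs : RowSpec} {r : Row} (h : buildRow c rs = some r) : r.Holds x ∧ r.WF := by
  cases rs with
  | c25 t =>
    simp only [buildRow] at h
    split at h
    · next k hk =>
      split_ifs at h with ht
      cases h
      refine ⟨M.c25A k t hk ht.1 ht.2.1 ht.2.2.1 ht.2.2.2.1, ?_, ?_, ?_, ?_⟩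
      · intro p hp
        simp only [rowC25, List.mem_append, List.mem_replicate] at hp
        omega
      · intro p hp
        simp only [rowC25, List.mem_replicate] at hp
        omega
      · intro be hbe
        simp only [rowC25, List.mem_map] at hbe
        obtain ⟨u, -, rfl⟩ := hbe
        exact dist1_pos _ _
      · intro be hbe
        simp only [rowC25, List.mem_append, List.mem_map] at hbe
        rcases hbe with ⟨u, -, rfl⟩ | ⟨u, -, rfl⟩ <;> exact dist1_pos _ _
    · next z hz =>
      split_ifs at h with ht
      cases h
      refine ⟨M.c25B z t hz ht.1 ht.2.1, ?_, ?_, ?_, ?_⟩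
      · intro p hp
        simp only [rowC25B, rowC25, List.mem_map, List.mem_append, List.mem_replicate] at hp
        obtain ⟨i, hi, rfl⟩ := hp
        unfold liveSlot; split_ifs <;> omega
      · intro p hp
        simp only [rowC25B, rowC25, List.mem_map, List.mem_replicate] at hp
        obtain ⟨i, hi, rfl⟩ := hp
        unfold liveSlot; split_ifs <;> omega
      · intro be hbe
        simp only [rowC25B, rowC25, List.mem_map] at hbe
        obtain ⟨u, -, rfl⟩ := hbe
        exact dist1_pos _ _
      · intro be hbe
        simp only [rowC25B, rowC25, List.mem_append, List.mem_map] at hbe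
        rcases hbe with ⟨u, -, rfl⟩ | ⟨u, -, rfl⟩ <;> exact dist1_pos _ _
  | win p q r =>
    simp only [buildRow] at h
    split at h
    · next k hk =>
      split at h
      · next w0 φ hw =>
        cases h
        have hk20 : k < 20 := by have := M.wf.hmode; rw [hk] at this; simpa [Mode.ok] using this
        have hlt : p < q ∧ q < r ∧ r < 21 := by
          rcases winSpec_cases hw with ⟨-, hp, hq, hr, -⟩ | ⟨h3, hq, hr, hp, -⟩ | ⟨-, h2, hp, hr, hq, -⟩ <;> omega
        have hφ : 0 < φ := by
          rcases winSpec_cases hw with ⟨-, -, -, -, -, e⟩ | ⟨-, -, -, -, -, e⟩ | ⟨-, -, -, -, -, -, -, e⟩ <;> omega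
        have epq := E_getD_lt M hlt.1 (hlt.2.1.trans hlt.2.2)
        have eqr := E_getD_lt M hlt.2.1 hlt.2.2
        refine ⟨rowWin_holds M hk hw, ?_, ?_, ?_, ?_⟩
        · intro u hu
          simp only [rowWin, List.mem_append, List.mem_replicate] at hu
          omega
        · intro u hu
          simp only [rowWin, List.mem_replicate] at hu
          omega
        · intro be hbe
          simp only [rowWin, List.mem_append, List.mem_cons, List.not_mem_nil, or_false] at hbe
          rcases hbe with hbe | rfl | rfl | rfl
          · exact redW_pos _ _ _ _ be hbe
          · exact hφ
          · show 0 < c.E.getD q 0 - c.E.getD p 0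
            omega
          · show 0 < c.E.getD r 0 - c.E.getD q 0
            omega
        · intro be hbe
          simp only [rowWin, List.mem_append, List.mem_singleton] at hbe
          rcases hbe with (hbe | hbe) | rfl
          · exact redW_pos _ _ _ _ be hbe
          · exact redW_pos _ _ _ _ be hbe
          · show 0 < c.E.getD q 0 - c.E.getD p 0 + (c.E.getD r 0 - c.E.getD q 0)
            omega
      · cases h
    · cases h
  | one P n =>
    simp only [buildRow] at h
    split at h
    · next p hp =>
      split_ifs at h with hn
      cases h
      simp only [Bool.and_eq_true, decide_eq_true_eq, Bool.not_eq_true'] at hn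
      obtain ⟨⟨hn1, hn2⟩, hz⟩ := hn
      obtain ⟨hval, hpos, -⟩ := posIndex_spec hp
      have hpl := lt_length_of_posTerms_eq hpos
      refine ⟨rowOne_holds M hp hn1 hn2 hz, ?_, ?_, ?_, ?_⟩
      · exact posl_lt_21 M (atoms_valid P hval _ (term_getD_mem P.poly hn1))
      · exact posl_lt_21 M (atoms_valid P hval _ (term_getD_mem P.poly hpl))
      · intro be hbe
        simp only [rowOne, List.mem_singleton] at hbe
        subst hbe
        exact Int.natAbs_pos.2 (coeff_ne_zero P _ (term_getD_mem P.poly hpl))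
      · intro be hbe
        simp only [rowOne, List.mem_singleton] at hbe
        subst hbe
        exact Int.natAbs_pos.2 (coeff_ne_zero P _ (term_getD_mem P.poly hn1))
    · cases h
  | amgm P S =>
    simp only [buildRow] at h
    split at h
    · next p hp =>
      split_ifs at h with hc
      cases h
      simp only [Bool.and_eq_true, decide_eq_true_eq, List.all_eq_true, Bool.not_eq_true'] at hc
      obtain ⟨⟨⟨hS, hSz⟩, hSnd⟩, hSne⟩ := hc
      obtain ⟨hval, hpos, -⟩ := posIndex_spec hp
      have hpl := lt_length_of_posTerms_eq hpos
      refine ⟨rowAmgm_holds M hp S hS hSz hSnd, ?_, ?_, ?_, ?_⟩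
      · intro q hq
        simp only [rowAmgm, List.mem_flatten, List.mem_map] at hq
        obtain ⟨l, ⟨j, hj, rfl⟩, hq⟩ := hq
        exact posl_lt_21 M (atoms_valid P hval _ (term_getD_mem P.poly (hS j hj).1)) q hq
      · intro q hq
        simp only [rowAmgm, List.mem_flatten, List.mem_replicate] at hq
        obtain ⟨l, ⟨-, rfl⟩, hq⟩ := hq
        exact posl_lt_21 M (atoms_valid P hval _ (term_getD_mem P.poly hpl)) q hq
      · intro be hbe
        simp only [rowAmgm, List.mem_singleton] at hbe
        subst hbe
        exact Int.natAbs_pos.2 (coeff_ne_zero P _ (term_getD_mem P.poly hpl))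
      · intro be hbe
        simp only [rowAmgm, List.mem_cons, List.mem_map] at hbe
        rcases hbe with rfl | ⟨j, hj, rfl⟩
        · exact List.length_pos_iff.2 hSne
        · exact Int.natAbs_pos.2 (coeff_ne_zero P _ (term_getD_mem P.poly (hS j hj).1))
    · cases h

end Rows

end Summit.ValiantsHypothesis.ValiantsHypothesis.Theorems.LacunarySymmetroidMatrixDescartes.Census.V19S
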